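import Summits.Ventures.Crystal3D.Theorems.StickyWulffConstantCoaxialWallLawLayeredLocal
import HarnessLib

/-!
# The off-site budget of `stub_coaxialTwoSlabAdhesion`, I: the local contact law at an on-site ball of an ARBITRARY filling

HONEST FRAMING. Part of the venture `Summits/Ventures/Crystal3D` (cell `crystal3d-full`), helper
`--supports` the crux `CoaxialWallLaw` (stmt-Ventures-19481, `route-Ventures-StickyWulffConstant`),
REGISTERED line `WallLedgerF` (planner cf-p1 gen 16), open stub `stub_coaxialTwoSlabAdhesion`.
RUNG CREDIT ONLY; F-C1 not moved.  Planner programme (xxix) (F-loc)/(F-off): after the LAYERED rung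
(`…CoaxialWallLawLayered`: the stub for fillings on the co-axial site lattice), quantify what an ARBITRARY
filling must spend OFF the site lattice to beat the charge.  This file is the local half:

* **`onSite_card_contacts_add_vacant_le`** — `X` `1`-separated (nothing else), `z ∈ X` a SITE of the frame
  `(L, s)` (`z = L(i u₁ + j u₂ + c w + k ν) + s`; `z ∈ X` is not even needed).  Then
  `deg z + #{d ∈ SIX(L) : z + d ∉ X} ≤ 12 + #{q ∈ X : |q − z| = 1, q NOT a site}`:
  the on-site contacts of `z` obey the layered law verbatim (`…LayeredLocal`: in-plane ones at the six sites,
  at most three one layer up, three one layer down), and every OFF-SITE contact is simply paid for.  So a vacant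
  in-plane site of an on-site ball is a missing contact of that ball UNLESS an off-site ball touches it —
  the exchange rate of the off-site budget law (`…CoaxialWallLawOffSite`).

WHAT THIS IS NOT: no statement about off-site balls themselves; F-C1 not moved.
-/

noncomputable section

namespace Summit.Ventures.Crystal3D.Theorems

open Summit.Ventures.Crystal3D Finset
open Literature.MathematicalPhysics.StatisticalMechanics (triangularVec₁ triangularVec₂ barlowOffset
  layerNormal)
open scoped InnerProductSpace

open scoped Classical in
/-- **The local contact law at an ON-SITE ball of an arbitrary filling.**  See the module docstring: for `X`
`1`-separated and `z ∈ X` a site of the frame `(L, s)`,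
`deg z + #{d ∈ SIX(L) : z + d ∉ X} ≤ 12 + #{off-site contacts of z}`. -/
theorem onSite_card_contacts_add_vacant_le
    (L : EuclideanSpace ℝ (Fin 3) ≃ₗᵢ[ℝ] EuclideanSpace ℝ (Fin 3)) (s : EuclideanSpace ℝ (Fin 3))
    (X : Finset (EuclideanSpace ℝ (Fin 3)))
    (hX : ∀ p ∈ X, ∀ q ∈ X, p ≠ q → 1 ≤ dist p q)
    {z : EuclideanSpace ℝ (Fin 3)}
    (hzsite : ∃ i j c k : ℤ, z = L ((i : ℝ) • triangularVec₁ (1 : ℝ) + (j : ℝ) • triangularVec₂ (1 : ℝ) +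
      (c : ℝ) • barlowOffset (1 : ℝ) + (k : ℝ) • layerNormal (Real.sqrt (2 / 3))) + s) :
    (X.filter fun q => dist z q = 1).card +
      (({L (triangularVec₁ 1), -L (triangularVec₁ 1), L (triangularVec₂ 1), -L (triangularVec₂ 1),
          L (triangularVec₂ 1 - triangularVec₁ 1), -L (triangularVec₂ 1 - triangularVec₁ 1)} :
          Finset (EuclideanSpace ℝ (Fin 3))).filter fun d => z + d ∉ X).card ≤
      12 + (X.filter fun q => dist z q = 1 ∧ ¬ ∃ i j c k : ℤ, q = L ((i : ℝ) • triangularVec₁ (1 : ℝ) +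
        (j : ℝ) • triangularVec₂ (1 : ℝ) + (c : ℝ) • barlowOffset (1 : ℝ) +
        (k : ℝ) • layerNormal (Real.sqrt (2 / 3))) + s).card := by
  set e₃ : EuclideanSpace ℝ (Fin 3) := EuclideanSpace.single (2 : Fin 3) (1 : ℝ) with he₃
  set n : EuclideanSpace ℝ (Fin 3) := L e₃ with hn
  set SIX : Finset (EuclideanSpace ℝ (Fin 3)) := {L (triangularVec₁ 1), -L (triangularVec₁ 1),
    L (triangularVec₂ 1), -L (triangularVec₂ 1), L (triangularVec₂ 1 - triangularVec₁ 1),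
    -L (triangularVec₂ 1 - triangularVec₁ 1)} with hSIX
  set Call : Finset (EuclideanSpace ℝ (Fin 3)) := X.filter fun q => dist z q = 1 with hCall
  set Coff : Finset (EuclideanSpace ℝ (Fin 3)) := X.filter fun q => dist z q = 1 ∧ ¬ ∃ i j c k : ℤ,
    q = L ((i : ℝ) • triangularVec₁ (1 : ℝ) + (j : ℝ) • triangularVec₂ (1 : ℝ) + (c : ℝ) • barlowOffset (1 : ℝ) +
      (k : ℝ) • layerNormal (Real.sqrt (2 / 3))) + s with hCoff
  set C : Finset (EuclideanSpace ℝ (Fin 3)) := Call.filter fun q => ∃ i j c k : ℤ,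
    q = L ((i : ℝ) • triangularVec₁ (1 : ℝ) + (j : ℝ) • triangularVec₂ (1 : ℝ) + (c : ℝ) • barlowOffset (1 : ℝ) +
      (k : ℝ) • layerNormal (Real.sqrt (2 / 3))) + s with hC
  have hCsplit : Call.card = C.card + Coff.card := by
    rw [hC, hCoff, hCall, Finset.filter_filter, ← card_filter_add_card_filter_not (s := Call) (fun q => ∃ i j c k : ℤ,
      q = L ((i : ℝ) • triangularVec₁ (1 : ℝ) + (j : ℝ) • triangularVec₂ (1 : ℝ) + (c : ℝ) • barlowOffset (1 : ℝ) +
      (k : ℝ) • layerNormal (Real.sqrt (2 / 3))) + s)]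
    rw [hCall, Finset.filter_filter, Finset.filter_filter]
  have hCX : ∀ q ∈ C, q ∈ X ∧ dist z q = 1 := fun q hq => by
    rw [hC, mem_filter, hCall, mem_filter] at hq; exact hq.1
  have he₃1 : ‖e₃‖ = 1 := by rw [he₃, PiLp.norm_single, norm_one]
  have hn1 : ‖n‖ = 1 := by rw [hn, LinearIsometryEquiv.norm_map, he₃1]
  obtain ⟨i, j, c, k, hzrep⟩ := hzsite
  -- every contact is `z + L(site vector of norm 1)`; record its layer jump
  have hrep : ∀ q ∈ C, ∃ i' j' c' k' : ℤ,
      q - z = L (((i' : ℤ) : ℝ) • triangularVec₁ (1 : ℝ) + ((j' : ℤ) : ℝ) • triangularVec₂ (1 : ℝ) +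
        ((c' : ℤ) : ℝ) • barlowOffset (1 : ℝ) + ((k' : ℤ) : ℝ) • layerNormal (Real.sqrt (2 / 3))) ∧
      ‖((i' : ℤ) : ℝ) • triangularVec₁ (1 : ℝ) + ((j' : ℤ) : ℝ) • triangularVec₂ (1 : ℝ) +
        ((c' : ℤ) : ℝ) • barlowOffset (1 : ℝ) + ((k' : ℤ) : ℝ) • layerNormal (Real.sqrt (2 / 3))‖ = 1 ∧
      ⟪q - z, n⟫_ℝ = k' * Real.sqrt (2 / 3) := by
    intro q hq
    have hq' := hq
    rw [hC, mem_filter] at hq'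
    obtain ⟨-, i', j', c', k', hqrep⟩ := hq'
    obtain ⟨hqX, hqd⟩ := hCX q hq
    refine ⟨i' - i, j' - j, c' - c, k' - k, ?_, ?_, ?_⟩
    · rw [hqrep, hzrep, site_sub_site]
    · have : ‖q - z‖ = 1 := by rw [← dist_eq_norm, dist_comm, hqd]
      rw [hqrep, hzrep, site_sub_site, LinearIsometryEquiv.norm_map] at this
      exact this
    · rw [hqrep, hzrep, site_sub_site, hn, LinearIsometryEquiv.inner_map_map,
        EuclideanSpace.inner_single_right, site_apply_two]
      simp
  -- split by layer
  set C0 := C.filter fun q => ⟪q - z, n⟫_ℝ = 0 with hC0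
  set Cp := C.filter fun q => 0 < ⟪q - z, n⟫_ℝ with hCp
  set Cm := C.filter fun q => ⟪q - z, n⟫_ℝ < 0 with hCm
  have hsplit : C ⊆ C0 ∪ Cp ∪ Cm := by
    intro q hq
    rcases lt_trichotomy 0 ⟪q - z, n⟫_ℝ with h | h | h
    · exact mem_union_left _ (mem_union_right _ (mem_filter.2 ⟨hq, h⟩))
    · exact mem_union_left _ (mem_union_left _ (mem_filter.2 ⟨hq, h.symm⟩))
    · exact mem_union_right _ (mem_filter.2 ⟨hq, h⟩)
  have hcardC : C.card ≤ C0.card + Cp.card + Cm.card :=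
    (card_le_card hsplit).trans ((card_union_le _ _).trans (by
      have := card_union_le C0 Cp; omega))
  -- (1) in-plane contacts sit at the six in-plane sites
  have hC0 : C0.card ≤ (SIX.filter fun d => z + d ∈ X).card := by
    refine card_le_card_of_injOn (fun q => q - z) ?_ ?_
    · intro q hq
      rw [mem_coe, hC0, mem_filter] at hq
      obtain ⟨hqC, hq0⟩ := hq
      obtain ⟨i', j', c', k', hqz, hnorm, hinner⟩ := hrep q hqC
      have hk' : k' = 0 := by
        rw [hinner] at hq0
        have hs : Real.sqrt (2 / 3) ≠ 0 := by positivity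
        exact_mod_cast (mul_eq_zero.1 hq0).resolve_right hs
      subst hk'
      have hsix := site_unit_inPlane_mem_six hnorm
      rw [mem_coe, mem_filter]
      refine ⟨?_, by simp only [add_sub_cancel]; exact (hCX q hqC).1⟩
      show q - z ∈ SIX
      rw [hqz]
      simp only [mem_insert, mem_singleton] at hsix
      rcases hsix with h | h | h | h | h | h <;> rw [h] <;> simp [hSIX, map_neg]
    · intro q _ q' _ hqq'
      simpa using hqq'
  -- (2) at most three contacts one layer up, (3) one layer down
  have hcap : ∀ (m : EuclideanSpace ℝ (Fin 3)), (m = n ∨ m = -n) →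
      ((C.filter fun q => 0 < ⟪q - z, m⟫_ℝ).card ≤ 3) := by
    intro m hm
    have hm1 : ‖m‖ = 1 := by rcases hm with rfl | rfl; exact hn1; rw [norm_neg, hn1]
    set Cq := C.filter fun q => 0 < ⟪q - z, m⟫_ℝ with hCq
    have hinj : Set.InjOn (fun q => q - z) ↑Cq := by
      intro q _ q' _ hqq'; simpa using hqq'
    rw [← card_image_of_injOn hinj]
    refine card_le_three_of_polarCap hm1 _ ?_ ?_ ?_ ?_
    · intro u hu
      obtain ⟨q, hq, rfl⟩ := mem_image.1 hu
      obtain ⟨-, -, hnorm, -⟩ := hrep q (mem_filter.1 hq).1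
      obtain ⟨i', j', c', k', hqz, hnorm, -⟩ := hrep q (mem_filter.1 hq).1
      rw [hqz, LinearIsometryEquiv.norm_map, hnorm]
    · intro u hu
      obtain ⟨q, hq, rfl⟩ := mem_image.1 hu
      exact (mem_filter.1 hq).2
    · intro u hu
      obtain ⟨q, hq, rfl⟩ := mem_image.1 hu
      obtain ⟨hqC, hpos⟩ := mem_filter.1 hq
      obtain ⟨i', j', c', k', hqz, hnorm, hinner⟩ := hrep q hqC
      have hmn : ⟪q - z, m⟫_ℝ ^ 2 = ⟪q - z, n⟫_ℝ ^ 2 := by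
        rcases hm with rfl | rfl
        · rfl
        · rw [inner_neg_right, neg_sq]
      rw [hmn, hinner]
      have hH : Real.sqrt (2 / 3) ^ 2 = 2 / 3 := Real.sq_sqrt (by norm_num)
      have hk'0 : k' ≠ 0 := by
        rintro rfl
        have : ⟪q - z, m⟫_ℝ = 0 := by
          rcases hm with rfl | rfl
          · rw [hinner]; simp
          · rw [inner_neg_right, hinner]; simp
        rw [this] at hpos; exact lt_irrefl _ hpos
      have hk'1 : (k' : ℝ) ^ 2 = 1 := by
        rcases site_unit_layer hnorm with h | h | h
        · exact absurd h hk'0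
        · rw [h]; norm_num
        · rw [h]; norm_num
      nlinarith [hk'1, hH]
    · intro u hu u' hu' huu'
      obtain ⟨q, hq, rfl⟩ := mem_image.1 hu
      obtain ⟨q', hq', rfl⟩ := mem_image.1 hu'
      have hqC := hCX q (mem_filter.1 hq).1
      have hq'C := hCX q' (mem_filter.1 hq').1
      have hne : q ≠ q' := fun h => huu' (by rw [h])
      have hd := hX q hqC.1 q' hq'C.1 hne
      have hu1 : ‖q - z‖ = 1 := by rw [← dist_eq_norm, dist_comm, hqC.2]
      have hu1' : ‖q' - z‖ = 1 := by rw [← dist_eq_norm, dist_comm, hq'C.2]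
      have hdd : dist q q' = ‖(q - z) - (q' - z)‖ := by rw [dist_eq_norm]; congr 1; abel
      have hexp : ‖(q - z) - (q' - z)‖ ^ 2 = ‖q - z‖ ^ 2 - 2 * ⟪q - z, q' - z⟫_ℝ + ‖q' - z‖ ^ 2 :=
        norm_sub_sq_real _ _
      rw [hu1, hu1', ← hdd] at hexp
      nlinarith [hexp, hd]
  have hCp : Cp.card ≤ 3 := hcap n (Or.inl rfl)
  have hCm : Cm.card ≤ 3 := by
    have h := hcap (-n) (Or.inr rfl)
    have hEq : Cm = C.filter fun q => 0 < ⟪q - z, -n⟫_ℝ := by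
      rw [hCm]; congr 1; ext q; rw [inner_neg_right]; constructor <;> intro h' <;> linarith
    rw [hEq]; exact h
  -- (4) the six in-plane sites split into occupied and vacant
  have hsix : (SIX.filter fun d => z + d ∈ X).card + (SIX.filter fun d => z + d ∉ X).card ≤ 6 := by
    rw [card_filter_add_card_filter_not]
    rw [hSIX]
    refine (card_insert_le _ _).trans (Nat.succ_le_succ ?_)
    refine (card_insert_le _ _).trans (Nat.succ_le_succ ?_)
    refine (card_insert_le _ _).trans (Nat.succ_le_succ ?_)
    refine (card_insert_le _ _).trans (Nat.succ_le_succ ?_)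
    refine (card_insert_le _ _).trans (Nat.succ_le_succ ?_)
    rw [card_singleton]
  show Call.card + (SIX.filter fun d => z + d ∉ X).card ≤ 12 + Coff.card
  omega

end Summit.Ventures.Crystal3D.Theorems

end
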